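import Mathlib
import Summits.Ventures.PercRepro2.Defs
import Summits.Ventures.PercRepro2.Independence
import Summits.Ventures.PercRepro2.Harris
import Summits.Ventures.PercRepro2.Graph
import Summits.Ventures.PercRepro2.Exploration
import Summits.Ventures.PercRepro2.Events
import Summits.Ventures.PercRepro2.FourFunctions
import Summits.Ventures.PercRepro2.Induced
import Summits.Ventures.PercRepro2.Frontier
import Summits.Ventures.PercRepro2.ObsIndependence
import Summits.Ventures.PercRepro2.BHK
import Summits.Ventures.PercRepro2.BHKEvents
import Summits.Ventures.PercRepro2.SideAgreement
import Summits.Ventures.PercRepro2.VdBKahn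
import Summits.Ventures.PercRepro2.BHKAvoid
import Summits.Ventures.PercRepro2.R2PrimeThreeReduction
import Summits.Ventures.PercRepro2.YBridge
import Summits.Ventures.PercRepro2.Yu1Functionals
import Summits.Ventures.PercRepro2.Yu1Events
import Summits.Ventures.PercRepro2.Yu1
import Summits.Ventures.PercRepro2.LBSplit
import Summits.Ventures.PercRepro2.YDelta
import Summits.Ventures.PercRepro2.SD
import Summits.Ventures.PercRepro2.Threshold
import Summits.Ventures.PercRepro2.Lambda
import Summits.Ventures.PercRepro2.LambdaTau
import Summits.Ventures.PercRepro2.LambdaSlack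
import Summits.Ventures.PercRepro2.HF2
import Summits.Ventures.PercRepro2.Yu2
import Summits.Ventures.PercRepro2.N0
import Summits.Ventures.PercRepro2.Y
import Summits.Ventures.PercRepro2.YDeltaTools
import Summits.Ventures.PercRepro2.ZDelta
import Summits.Ventures.PercRepro2.ZExpand
import Summits.Ventures.PercRepro2.ISplit
import Summits.Ventures.PercRepro2.MRl
import Summits.Ventures.PercRepro2.ZOloc
import Summits.Ventures.PercRepro2.SideBridge
import Summits.Ventures.PercRepro2.HCov
import Summits.Ventures.PercRepro2.ChordBase

/-!
# (AVG-CHORD) ⟹ (HCOV): the induction (blind cell PercRepro2, typer-1; mine-a g1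
`MINEA-LOCALSUPER.md` §10–§11, INBOX 2026-08-23T08:2xZ (iii); lead ASSIGNMENTS v11.7 (4))

On top of `ChordBase` (vocabulary `oneConfig`, `frac`, `rootEdges`, `Gloc`, row `AvgChord`, and the
base lemma `Gc_eq_zero_of_rootEdges_empty`):

* `Gc_eq_zero_of_degenerate`: `D · P(Q) = 0` forces `Gc = 0`;
* **`ExistsChord`** (mine-a's hypothesis of record after NEG (AVG-CHORD), 09:22Z): some
  fractional root edge satisfies its chord inequality; `existsChord_of_avgChord`;
* **`Gloc_nonneg_of_existsChord`** (mine-a's supermartingale argument without exploration trees,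
  Theorem 2): strong induction on `|frac p|` — the chosen root edge's children have one fractional
  edge fewer; when no root edge is fractional, `Gloc = 0` by the base lemma;
* **`HCov_of_existsChord`** / **`HCov_all_of_existsChord_all`**: (EXISTS-CHORD) at every admissible
  weight vector gives (HCOV) there, hence (with `ZDelta_all_of_HCov_all`) the crux (ZΔ) — a
  reduction with NO exploration inside it; the (AVG-CHORD) versions are corollaries.
-/

namespace Summit.Ventures.PercRepro2

open UnionCluster CovForm

namespace Chord

open scoped Classical

/-! ## Degenerate instances -/

section Degenerate

variable {V : Type*} {E : Type*} [Fintype E] [DecidableEq E] {R : Type*} [Field R]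
  [LinearOrder R] [IsStrictOrderedRing R]

omit [Fintype E] [DecidableEq E] in
/-- `PD ⊆ Q`. -/
lemma PDEvent_subset_avoidAll (ends : E → Sym2 V) (a₁ a₂ a₃ : V) :
    PDEvent ends a₁ a₂ a₃ ⊆ avoidAll ends a₂ {a₁} := by
  intro ω hω
  simp only [avoidAll, Set.mem_setOf_eq, Finset.mem_singleton, forall_eq]
  exact fun h => hω.1 (conn_symm h)

/-- When `D · P(Q) = 0`, `Gc = 0` (`D = 0` kills every term). -/
lemma Gc_eq_zero_of_degenerate {p : E → R} (hp : IsProbVec p) (ends : E → Sym2 V)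
    (o a₁ a₂ a₃ b : V)
    (h : prob p (PDEvent ends a₁ a₂ a₃) * prob p (avoidAll ends a₂ {a₁}) = 0) :
    Gc p ends o a₁ a₂ a₃ b = 0 := by
  have hD : prob p (PDEvent ends a₁ a₂ a₃) = 0 := by
    rcases mul_eq_zero.1 h with h | hQ
    · exact h
    · exact le_antisymm (hQ ▸ prob_mono hp (PDEvent_subset_avoidAll ends a₁ a₂ a₃))
        (prob_nonneg hp _)
  have hDo : Do p ends o a₁ a₂ a₃ = 0 := by
    unfold Do
    have h1 := prob_inter_le_left hp (PDEvent ends a₁ a₂ a₃) (connEvent ends a₁ o)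
    have h2 := prob_inter_le_left hp (PDEvent ends a₁ a₂ a₃) (connEvent ends a₂ o)
    have h3 := prob_nonneg hp (PDEvent ends a₁ a₂ a₃ ∩ connEvent ends a₁ o)
    have h4 := prob_nonneg hp (PDEvent ends a₁ a₂ a₃ ∩ connEvent ends a₂ o)
    linarith
  unfold Gc DEF
  rw [hD, hDo]
  ring

end Degenerate

/-! ## The induction -/

section Induction

variable {V : Type*} {E : Type*} [Fintype E] [DecidableEq E] {R : Type*} [Field R]
  [LinearOrder R] [IsStrictOrderedRing R]

/-- `Gloc = 0` with no fractional root edge. -/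
lemma Gloc_eq_zero_of_rootEdges_empty {p : E → R} {ends : E → Sym2 V}
    {a₁ a₂ : V} (h0 : rootEdges p ends a₁ a₂ = ∅) (o a₃ b : V) :
    Gloc p ends o a₁ a₂ a₃ b = 0 := by
  unfold Gloc
  rw [Gc_eq_zero_of_rootEdges_empty h0, zero_div]

/-- **(EXISTS-CHORD)** at the weight vector `p` (mine-a §11, the hypothesis of record after
NEG (AVG-CHORD)): if some root edge is fractional, SOME root edge `e` satisfies its chord
inequality `p_e · Gloc p[e↦1] + (1 − p_e) · Gloc p[e↦0] ≤ Gloc p`. -/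
def ExistsChord (p : E → R) (ends : E → Sym2 V) (o a₁ a₂ a₃ b : V) : Prop :=
  (rootEdges p ends a₁ a₂).Nonempty →
    ∃ e ∈ rootEdges p ends a₁ a₂,
      p e * Gloc (Function.update p e 1) ends o a₁ a₂ a₃ b +
        (1 - p e) * Gloc (Function.update p e 0) ends o a₁ a₂ a₃ b ≤ Gloc p ends o a₁ a₂ a₃ b

/-- An average bounded by `Gloc p` forces one term bounded by `Gloc p`: (AVG-CHORD) ⟹ (EXISTS-CHORD). -/
theorem existsChord_of_avgChord {p : E → R} {ends : E → Sym2 V} {o a₁ a₂ a₃ b : V}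
    (h : AvgChord p ends o a₁ a₂ a₃ b) : ExistsChord p ends o a₁ a₂ a₃ b := by
  intro hne
  by_contra hcon
  push Not at hcon
  have hlt : (rootEdges p ends a₁ a₂).card * Gloc p ends o a₁ a₂ a₃ b <
      ∑ e ∈ rootEdges p ends a₁ a₂,
        (p e * Gloc (Function.update p e 1) ends o a₁ a₂ a₃ b +
          (1 - p e) * Gloc (Function.update p e 0) ends o a₁ a₂ a₃ b) := by
    rw [← nsmul_eq_mul, ← Finset.sum_const]
    exact Finset.sum_lt_sum_of_nonempty hne fun e he => hcon e he
  exact absurd (h hne) (not_le.2 hlt)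

/-- **(EXISTS-CHORD) ⟹ `Gloc ≥ 0`** (mine-a §11, Theorem 2): strong induction on the number of
fractional edges; the children `p[e↦1]`, `p[e↦0]` of a root edge have one fractional edge fewer. -/
theorem Gloc_nonneg_of_existsChord (ends : E → Sym2 V) (o a₁ a₂ a₃ b : V)
    (hex : ∀ q : E → R, IsProbVec q → ExistsChord q ends o a₁ a₂ a₃ b) :
    ∀ (n : ℕ) (p : E → R), IsProbVec p → (frac p).card = n → 0 ≤ Gloc p ends o a₁ a₂ a₃ b := by
  intro n
  induction n using Nat.strong_induction_on with
  | _ n ih =>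
  intro p hp hn
  by_cases h0 : rootEdges p ends a₁ a₂ = ∅
  · rw [Gloc_eq_zero_of_rootEdges_empty h0]
  · obtain ⟨e, he, hle⟩ := hex p hp (Finset.nonempty_iff_ne_empty.2 h0)
    have hf := frac_of_mem_rootEdges he
    have hlt : ((frac p).erase e).card < n := by
      rw [← hn]
      exact Finset.card_erase_lt_of_mem hf
    have h1 := ih _ hlt _ (hp.update e zero_le_one le_rfl) (by rw [frac_update_one hf])
    have h2 := ih _ hlt _ (hp.update e le_rfl zero_le_one) (by rw [frac_update_zero hf])
    exact (add_nonneg (mul_nonneg (hp.nonneg e) h1)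
      (mul_nonneg (sub_nonneg.2 (hp.le_one e)) h2)).trans hle

/-- **(EXISTS-CHORD) ⟹ (HCOV)** at every admissible weight vector of the instance. -/
theorem HCov_of_existsChord (ends : E → Sym2 V) (o a₁ a₂ a₃ b : V)
    (hex : ∀ q : E → R, IsProbVec q → ExistsChord q ends o a₁ a₂ a₃ b) (p : E → R)
    (hp : IsProbVec p) : HCov p ends o a₁ a₂ a₃ b := by
  unfold HCov
  have hG := Gloc_nonneg_of_existsChord ends o a₁ a₂ a₃ b hex _ p hp rfl
  by_cases hden : prob p (PDEvent ends a₁ a₂ a₃) * prob p (avoidAll ends a₂ {a₁}) = 0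
  · rw [Gc_eq_zero_of_degenerate hp ends o a₁ a₂ a₃ b hden]
  · have hpos : 0 < prob p (PDEvent ends a₁ a₂ a₃) * prob p (avoidAll ends a₂ {a₁}) :=
      lt_of_le_of_ne (mul_nonneg (prob_nonneg hp _) (prob_nonneg hp _)) (Ne.symm hden)
    unfold Gloc at hG
    exact (div_nonneg_iff.1 hG).elim (fun h => h.1) (fun h => by
      exact absurd h.2 (not_le.2 hpos))

/-- (AVG-CHORD) ⟹ (HCOV) (the false row still implies the crux: a true implication). -/
theorem HCov_of_avgChord (ends : E → Sym2 V) (o a₁ a₂ a₃ b : V)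
    (havg : ∀ q : E → R, IsProbVec q → AvgChord q ends o a₁ a₂ a₃ b) (p : E → R)
    (hp : IsProbVec p) : HCov p ends o a₁ a₂ a₃ b :=
  HCov_of_existsChord ends o a₁ a₂ a₃ b (fun q hq => existsChord_of_avgChord (havg q hq)) p hp

end Induction

section ChainAll

variable (R : Type*) [Field R] [LinearOrder R] [IsStrictOrderedRing R]

/-- Row (EXISTS-CHORD) over all finite graphs, admissible weights and markings. -/
def ExistsChord_all : Prop :=
  ∀ (V E : Type) [Fintype V] [DecidableEq V] [Fintype E] [DecidableEq E]
    (ends : E → Sym2 V) (p : E → R), IsProbVec p →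
    ∀ o a₁ a₂ a₃ b : V, a₁ ≠ a₂ → a₁ ≠ a₃ → a₂ ≠ a₃ → o ≠ a₁ → o ≠ a₂ → o ≠ a₃ → o ≠ b →
      b ≠ a₁ → b ≠ a₂ → b ≠ a₃ → ExistsChord p ends o a₁ a₂ a₃ b

/-- **(EXISTS-CHORD) on all instances ⟹ row 2′HCOV**, hence the crux (ZΔ) by `ZDelta_all_of_HCov_all`. -/
theorem HCov_all_of_existsChord_all (h : ExistsChord_all R) : HCov_all R := by
  intro V E _ _ _ _ ends p hp o a₁ a₂ a₃ b h12 h13 h23 ho1 ho2 ho3 hob hb1 hb2 hb3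
  exact HCov_of_existsChord ends o a₁ a₂ a₃ b
    (fun q hq => h V E ends q hq o a₁ a₂ a₃ b h12 h13 h23 ho1 ho2 ho3 hob hb1 hb2 hb3) p hp

/-- Row 2′AVGCHORD (refuted by mine-a at `n = 6`) would have implied row 2′HCOV. -/
theorem HCov_all_of_avgChord_all (h : AvgChord_all R) : HCov_all R :=
  HCov_all_of_existsChord_all R fun V E _ _ _ _ ends p hp o a₁ a₂ a₃ b h12 h13 h23 ho1 ho2 ho3
    hob hb1 hb2 hb3 =>
      existsChord_of_avgChord (h V E ends p hp o a₁ a₂ a₃ b h12 h13 h23 ho1 ho2 ho3 hob hb1 hb2 hb3)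

end ChainAll

end Chord

end Summit.Ventures.PercRepro2
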